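import Summits.AtomisticToContinuum.HydrodynamicLimit.Theses.OneFlightGossipEngine
import Summits.AtomisticToContinuum.HydrodynamicLimit.Theorems.AprioriBounds.Negative.FlowInvariance
import Summits.AtomisticToContinuum.HydrodynamicLimit.Theorems.OneFlightGossipEngineClampedTransferDockSeet
import Literature.Analysis.FluidPDE.HardSphereUniqueness
import Literature.MathematicalPhysics.KineticTheory.HardSphereEulerProofs

/-!
# `SuperExponentialEnergyTails` (stmt-AtomisticToContinuum-17701) at GLOBAL EQUILIBRIUM — the
equilibrium rung is TRUE, for all times, all `N`, every flow family (POSITIVE special case;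
evidence only, written by the standing disprover refuter-cdisprove-stmt-AtomisticToContinuum-17701-0
to certify that the crux cannot be refuted in the one regime where its horizon `T` is unbounded).

For the homogeneous profile `a₀ = 1`, `u₀ = 0`, `θ₀ = θ̄ > 0`, every `0 < σ < 1/2`, EVERY family of
hard-sphere flows `Φ` and every rate `c > 0` there is `K₀ > 0` with
`E_{λ_N} (N+1)⁻¹ ∑ᵢ 𝟙{K < |vᵢ(s)|}|vᵢ(s)|³ ≤ e^{-cK}` for ALL `K ≥ K₀`, ALL `N` and ALL times `s ∈ ℝ`
(`seet_homogeneous`; the crux's body verbatim at this profile in `seet_body_homogeneous`: `σ₀ = 1/2`,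
`N₀ = 0`, the slack `ε`, the Euler solution and the LLN hypothesis unused).  Ingredients, all landed:
a.e. uniqueness of hard-sphere flows (`HardSphereFlow.flow_eq_ae_holds`) to pass to the regularised
Alexander flow; invariance of the homogeneous local Gibbs law under it
(`AprioriBoundsNegative.measurePreserving_regFlow_localGibbsMeasure`, as in the sibling crux's
`Cruxes/EnergyCurrentTails/EquilibriumRung.lean`, whose `lintegral_comp_flow_eq` is copied here); and
the `s = 0` rung `ClampedTransferDockSeet.seet_time_zero` (Maxwellian velocities given the positions).
CONSEQUENCE (recorded in `Disproof.lean`): any counterexample to SEET is genuinely out of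
equilibrium; the equilibrium sector, the only one with `T = ∞`, is closed.
-/

noncomputable section

open MeasureTheory Filter Set Topology
open scoped ENNReal

namespace Summit.AtomisticToContinuum.HydrodynamicLimit.Cruxes.SuperExponentialEnergyTails.Equilibrium

open Literature.MathematicalPhysics.KineticTheory Literature.Analysis.FluidPDE
open Summit.AtomisticToContinuum.HydrodynamicLimit.Theorems.AprioriBoundsNegative
open Summit.AtomisticToContinuum.HydrodynamicLimit.Theorems.ClampedTransferDockSeet (seet_time_zero)

/-- The crux integrand `z ↦ ofReal ((N+1)⁻¹ ∑ᵢ 𝟙{K < |vᵢ|}|vᵢ|³)` is measurable. -/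
theorem measurable_cubicTailFn (N : ℕ) (K : ℝ) :
    Measurable fun z : Config (N + 1) (Fin 3) T3 => ENNReal.ofReal (((N : ℝ) + 1)⁻¹ *
      ∑ i : Fin (N + 1), Set.indicator {v : V3 | K < ‖v‖} (fun v => ‖v‖ ^ 3) ((z i).2)) := by
  refine (Measurable.const_mul (Finset.measurable_sum _ fun i _ => ?_) _).ennreal_ofReal
  exact ((measurable_norm.pow_const 3).indicator
    (measurableSet_lt measurable_const measurable_norm)).comp (measurable_pi_apply i).snd

/-- **Invariance** (copied from the sibling rung `Cruxes/EnergyCurrentTails/EquilibriumRung.lean`):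
under the homogeneous local Gibbs law, composing with ANY hard-sphere flow does not change
expectations. -/
theorem lintegral_comp_flow_eq {σ : ℝ} (hσ : 0 < σ) (hσ2 : σ < 1 / 2) (θb : ℝ) (N : ℕ)
    (Φ : HardSphereFlow (Torus.geometry (Fin 3)) (hsDiameter σ N) (N + 1)) (s : ℝ)
    {F : Config (N + 1) (Fin 3) T3 → ℝ≥0∞} (hF : Measurable F) :
    ∫⁻ z, F (Φ.flow s z) ∂(localGibbsMeasure σ (fun _ => 1) (fun _ => 0) (fun _ => θb) N) =
      ∫⁻ z, F z ∂(localGibbsMeasure σ (fun _ => 1) (fun _ => 0) (fun _ => θb) N) := by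
  have hε : 0 < hsDiameter σ N := hsDiameter_pos hσ N
  have hε' : hsDiameter σ N < 2⁻¹ := (hsDiameter_le hσ.le N).trans_lt (by linarith)
  set Ψ := Alexander.regHardSphereFlow (d := Fin 3) hε hε' (N + 1) with hΨ
  have hae : Φ.flow s =ᵐ[liouville (Torus.geometry (Fin 3)) (N + 1) (hsDiameter σ N)] Ψ.flow s :=
    HardSphereFlow.flow_eq_ae_holds Φ Ψ s
  have hae' : Φ.flow s =ᵐ[localGibbsMeasure σ (fun _ => 1) (fun _ => 0) (fun _ => θb) N] Ψ.flow s :=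
    (localGibbsMeasure_absolutelyContinuous σ _ _ _ N Φ).ae_le hae
  calc ∫⁻ z, F (Φ.flow s z) ∂(localGibbsMeasure σ (fun _ => 1) (fun _ => 0) (fun _ => θb) N)
      = ∫⁻ z, F (Ψ.flow s z) ∂(localGibbsMeasure σ (fun _ => 1) (fun _ => 0) (fun _ => θb) N) :=
        lintegral_congr_ae (hae'.mono fun z hz => by simp only [hz])
    _ = ∫⁻ z, F z ∂(localGibbsMeasure σ (fun _ => 1) (fun _ => 0) (fun _ => θb) N) :=
        (measurePreserving_regFlow_localGibbsMeasure hσ hσ2 θb N s).lintegral_comp hF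

/-- **SEET at global equilibrium, for all times.**  For the homogeneous profile (`a₀ = 1`, `u₀ = 0`,
`θ₀ = θ̄ > 0`), every `0 < σ < 1/2`, every family of hard-sphere flows and every rate `c > 0` there is
`K₀ > 0` such that the crux's expected empirical cubic tail above every level `K ≥ K₀` is `≤ e^{-cK}`
for ALL `N` and ALL times `s ∈ ℝ` — the conclusion of the crux in its exact currency, with no `N₀`, no
slack and no horizon: the expectation at time `s` equals the expectation at time `0` (invariance),
which is the `s = 0` rung `seet_time_zero`. -/
theorem seet_homogeneous {σ θb : ℝ} (hσ : 0 < σ) (hσ2 : σ < 1 / 2) (hθ : 0 < θb)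
    (Φ : (N : ℕ) → HardSphereFlow (Torus.geometry (Fin 3)) (hsDiameter σ N) (N + 1))
    {c : ℝ} (hc : 0 < c) :
    ∃ K₀ : ℝ, 0 < K₀ ∧ ∀ K : ℝ, K₀ ≤ K → ∀ N : ℕ, ∀ s : ℝ,
      ∫⁻ z, ENNReal.ofReal (((N : ℝ) + 1)⁻¹ * ∑ i : Fin (N + 1),
          Set.indicator {v : V3 | K < ‖v‖} (fun v => ‖v‖ ^ 3) (((Φ N).flow s z i).2))
        ∂(localGibbsLaw σ (fun _ => 1) (fun _ => 0) (fun _ => θb) N (Φ N)) ≤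
        ENNReal.ofReal (Real.exp (-(c * K))) := by
  obtain ⟨K₀, hK₀, hK⟩ := seet_time_zero (a₀ := fun _ => 1) (θ₀ := fun _ => θb) (u₀ := fun _ => 0)
    continuous_const continuous_const continuous_const (fun _ => one_pos) (fun _ => hθ) hσ2.le Φ hc
  refine ⟨K₀, hK₀, fun K hKK N s => ?_⟩
  have h0 := hK K hKK N
  rw [localGibbsLaw_eq] at h0 ⊢
  rw [lintegral_comp_flow_eq hσ hσ2 θb N (Φ N) s (measurable_cubicTailFn N K),
    ← lintegral_comp_flow_eq hσ hσ2 θb N (Φ N) 0 (measurable_cubicTailFn N K)]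
  exact h0

/-- **The crux's body, verbatim, at the homogeneous profile** `(a₀, u₀, θ₀) = (1, 0, θ̄)`: what
`SuperExponentialEnergyTails` asserts after its five profile hypotheses, with `σ₀ = 1/2`, `N₀ = 0`,
the slack, the Euler solution and the LLN hypothesis unused (they only bound the horizon). -/
theorem seet_body_homogeneous {θb : ℝ} (hθ : 0 < θb) :
    ∃ σ₀ : ℝ, 0 < σ₀ ∧ ∀ σ : ℝ, 0 < σ → σ < σ₀ →
      ∀ (T : ℝ) (ρ θ : ℝ → T3 → ℝ) (u : ℝ → T3 → V3), IsHardSphereEulerSolution σ T ρ u θ →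
        ∀ Φ : (N : ℕ) → HardSphereFlow (Torus.geometry (Fin 3)) (hsDiameter σ N) (N + 1),
          TendstoHydroFieldsAt (fun N => localGibbsLaw σ (fun _ => 1) (fun _ => 0) (fun _ => θb) N (Φ N))
              Φ ρ u θ 0 →
            ∀ t ∈ Set.Ico 0 T, ∀ c : ℝ, 0 < c → ∃ K₀ : ℝ, 0 < K₀ ∧ ∀ K : ℝ, K₀ ≤ K →
              ∀ ε : ℝ, 0 < ε → ∃ N₀ : ℕ, ∀ N : ℕ, N₀ ≤ N → ∀ s ∈ Set.Icc 0 t,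
                ∫⁻ z, ENNReal.ofReal (((N : ℝ) + 1)⁻¹ * ∑ i : Fin (N + 1),
                    Set.indicator {v : V3 | K < ‖v‖} (fun v => ‖v‖ ^ 3) (((Φ N).flow s z i).2))
                  ∂(localGibbsLaw σ (fun _ => 1) (fun _ => 0) (fun _ => θb) N (Φ N)) ≤
                  ENNReal.ofReal (Real.exp (-(c * K)) + ε) := by
  refine ⟨1 / 2, one_half_pos, fun σ hσ hσ2 T ρ θ u _ Φ _ t _ c hc => ?_⟩
  obtain ⟨K₀, hK₀, hK⟩ := seet_homogeneous hσ hσ2 hθ Φ hc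
  refine ⟨K₀, hK₀, fun K hKK ε hε => ⟨0, fun N _ s _ => ?_⟩⟩
  exact (hK K hKK N s).trans (ENNReal.ofReal_le_ofReal (by linarith))

/-- The profile-quantified form: the crux `SuperExponentialEnergyTails` restricted to the homogeneous
profiles `(1, 0, θ̄)`, `θ̄ > 0`, HOLDS. -/
theorem seet_restricted_homogeneous :
    ∀ θb : ℝ, 0 < θb →
      ∃ σ₀ : ℝ, 0 < σ₀ ∧ ∀ σ : ℝ, 0 < σ → σ < σ₀ →
      ∀ (T : ℝ) (ρ θ : ℝ → T3 → ℝ) (u : ℝ → T3 → V3), IsHardSphereEulerSolution σ T ρ u θ →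
        ∀ Φ : (N : ℕ) → HardSphereFlow (Torus.geometry (Fin 3)) (hsDiameter σ N) (N + 1),
          TendstoHydroFieldsAt (fun N => localGibbsLaw σ (fun _ => 1) (fun _ => 0) (fun _ => θb) N (Φ N))
              Φ ρ u θ 0 →
            ∀ t ∈ Set.Ico 0 T, ∀ c : ℝ, 0 < c → ∃ K₀ : ℝ, 0 < K₀ ∧ ∀ K : ℝ, K₀ ≤ K →
              ∀ ε : ℝ, 0 < ε → ∃ N₀ : ℕ, ∀ N : ℕ, N₀ ≤ N → ∀ s ∈ Set.Icc 0 t,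
                ∫⁻ z, ENNReal.ofReal (((N : ℝ) + 1)⁻¹ * ∑ i : Fin (N + 1),
                    Set.indicator {v : V3 | K < ‖v‖} (fun v => ‖v‖ ^ 3) (((Φ N).flow s z i).2))
                  ∂(localGibbsLaw σ (fun _ => 1) (fun _ => 0) (fun _ => θb) N (Φ N)) ≤
                  ENNReal.ofReal (Real.exp (-(c * K)) + ε) :=
  fun _ hθ => seet_body_homogeneous hθ

end Summit.AtomisticToContinuum.HydrodynamicLimit.Cruxes.SuperExponentialEnergyTails.Equilibrium

end
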